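import Summits.ABC.ABC.Theses.FeketeScales
import HarnessLib

/-!
# Route FeketeScales — glue item `TargetOfCruxes` (stmt-ABC-14163)

The route target `Target` of `FeketeScales` is rendered with the bodies of the two cruxes
`ScaleSubmultiplicativity` (scale sub-multiplicativity of the abc extremal height, G-free form)
and `SparseGoodScales` (abc along some unbounded sequence of radical scales) inlined verbatim,
so `Target` is definitionally `ScaleSubmultiplicativity ∧ SparseGoodScales`.  The support item
`TargetOfCruxes : ScaleSubmultiplicativity → SparseGoodScales → Target` is therefore the pairing
map; it carries no mathematics and only makes the target reachable from the ranked cruxes in the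
item graph.  No literature input; closes `--workitem stmt-ABC-14163`.
-/

-- `Summit.<Summit>.<Problem>` is the mandated summit-side namespace (CONVENTIONS §2); for the
-- single-conjunct summit `ABC` the two coincide, so the duplicate `ABC.ABC` is deliberate.
set_option linter.dupNamespace false

namespace Summit.ABC.ABC.Theorems

/-- **`TargetOfCruxes` holds** (route `FeketeScales`, item stmt-ABC-14163): the two cruxes
`ScaleSubmultiplicativity` and `SparseGoodScales` give the route target `Target`, which is by
construction their conjunction (both crux bodies are inlined in `Target`), so after unfolding the
goal is closed by the anonymous constructor `⟨h₁, h₂⟩`. -/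
theorem feketeScales_targetOfCruxes_proof :
    Summit.ABC.ABC.Theses.FeketeScales.TargetOfCruxes := by
  unfold Summit.ABC.ABC.Theses.FeketeScales.TargetOfCruxes
  intro h₁ h₂
  exact ⟨h₁, h₂⟩

end Summit.ABC.ABC.Theorems
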